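import Summits.Ventures.MM22.Rank333.GF2CertTransport
import HarnessLib

/-!
# MM22 venture, Route D3 — rectangular transpose transport and the sweep with hypotheses for `⟨l,m,n⟩`

HONEST FRAMING (cell `pub-mm22`, seat p3). Replay infrastructure only; no rank bound is claimed here.
`GF2CertTransport.lean` (this seat) proved the transpose transport for CUBIC formats. Wang's certificates for
RECTANGULAR formats (e.g. `cert_matrix_q02_n324`, `⟨3,2,4⟩` over `𝔽₂`, Route D3-PRIMARY) contain forced-product
steps of 'projection type 2' (single products among the OUTPUT slices), which the tree's checker
(`GF2ForcedProduct.lean`, cell `pub-omega`) does not implement — it implements projection type 1 (input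
slices). The automorphism `tr(XYZ) = tr(Xᵀ Zᵀ Yᵀ)` of the matrix multiplication tensor maps the constrained
problem `(⟨l,m,n⟩, S_K)` to `(⟨m,l,n⟩, S_{Kᵀ})` and EXCHANGES the second input with the output, hence output
slices with input slices: a projection-2 forced step on `(⟨l,m,n⟩, K)` is a projection-1 forced step on
`(⟨m,l,n⟩, Kᵀ)`. This file provides the transport that makes this usable, PROVED (0 sorry):

* `trbR l m κ` — the `m × l` bit pattern of the transposed constraint form; `form_trbR`;
* `transposeCompR` — from a computation of `(X', Y') ↦ X' Y'` on `S_{Kᵀ} × 𝔽₂^{l×n}` (`X'` of size `m × l`) a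
  computation of the same length of `(X, Y) ↦ X Y` on `S_K × 𝔽₂^{m×n}`; `cert_transposeR : Cert l m n K b → Cert m l n Kᵀ b`;
* `okH` / `sweepH` / `le_tensorRank_of_sweepH` — the sweep of `GF2OrbitSweep.lean` for general `⟨l,m,n⟩` with
  orbit bounds allowed as HYPOTHESES (`hypB`, from `GF2CertTransport.lean`), so that orbits proved in another
  format (by transport) or elsewhere can be plugged in.

References: Wang 2026, arXiv:2603.07280, §3.1, §6 (forced products, three cyclic positions); Hopcroft–Kerr 1971,
Lemma 2; tree files `GF2OrbitSweep.lean`, `GF2ForcedProduct.lean` (pub-omega), `GF2CertTransport.lean` (this seat).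
-/

namespace Summit.Ventures.MM22.GF2Cert

open Module Matrix Literature.Computability.AlgebraicComplexity
open Summit.MatrixMultiplication.OmegaCensus.GF2RankLB

/-! ## Transposed constraint forms, rectangular -/

/-- Bit pattern (on `m × l` matrices, position `pos l j i = i + l j`) of the transpose of the form with pattern `κ`
on `l × m` matrices (position `pos m i j = j + m i`). -/
def trbR (l m κ : ℕ) : ℕ := maskOf (fun p => κ.testBit (pos m (p % l) (p / l))) (m * l)

/-- Bits of `trbR`. -/
theorem testBit_trbR (l m κ : ℕ) (j : Fin m) (i : Fin l) :
    (trbR l m κ).testBit (pos l j i) = κ.testBit (pos m i j) := by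
  have hl : 0 < l := Fin.pos i
  have hlt : pos l j i < m * l := by
    have := i.2; have := j.2
    calc (i : ℕ) + l * j < l + l * j := by omega
      _ = l * (j + 1) := by ring
      _ ≤ l * m := Nat.mul_le_mul_left _ (by omega)
      _ = m * l := Nat.mul_comm _ _
  rw [trbR, testBit_maskOf]
  simp only [hlt, decide_true, Bool.true_and]
  have h1 : ((i : ℕ) + l * j) % l = i := by
    rw [Nat.add_mul_mod_self_left, Nat.mod_eq_of_lt i.2]
  have h2 : ((i : ℕ) + l * j) / l = j := by
    rw [Nat.add_mul_div_left _ _ hl, Nat.div_eq_of_lt i.2, zero_add]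
  simp only [pos, h1, h2]

/-- The transposed form evaluates on `X'` (`m × l`) as the form on `X'ᵀ`. -/
theorem form_trbR (l m κ : ℕ) (X' : Matrix (Fin m) (Fin l) (ZMod 2)) :
    form m l (trbR l m κ) X' = form l m κ X'ᵀ := by
  rw [form_apply, form_apply, Finset.sum_comm]
  refine Finset.sum_congr rfl fun i _ => Finset.sum_congr rfl fun j _ => ?_
  rw [testBit_trbR, transpose_apply]

/-- `X ∈ S_K ↔ Xᵀ ∈ S_{Kᵀ}` (rectangular). -/
theorem transpose_mem_subOf_iffR (l m : ℕ) (K : List ℕ) (X : Matrix (Fin l) (Fin m) (ZMod 2)) :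
    Xᵀ ∈ subOf m l (K.map (trbR l m)) ↔ X ∈ subOf l m K := by
  simp only [subOf, mem_constrSub, List.map_map, List.mem_map, forall_exists_index, and_imp,
    forall_apply_eq_imp_iff₂, Function.comp_apply, form_trbR, transpose_transpose]

/-- The transpose as a linear map `S_K → S_{Kᵀ}` (rectangular). -/
def trSubR (l m : ℕ) (K : List ℕ) : subOf l m K →ₗ[ZMod 2] subOf m l (K.map (trbR l m)) where
  toFun X := ⟨(X : Matrix (Fin l) (Fin m) (ZMod 2))ᵀ, (transpose_mem_subOf_iffR l m K X).2 X.2⟩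
  map_add' X Y := by ext; simp
  map_smul' a X := by ext; simp

/-- Coercion of `trSubR`. -/
@[simp] theorem coe_trSubR (l m : ℕ) (K : List ℕ) (X : subOf l m K) :
    (trSubR l m K X : Matrix (Fin m) (Fin l) (ZMod 2)) = (X : Matrix (Fin l) (Fin m) (ZMod 2))ᵀ := rfl

/-- The Frobenius pairing with a fixed `m × n` matrix `W`: `Y ↦ Σ_{p,q} W_{pq} Y_{pq}`. -/
def frobR (m n : ℕ) (W : Matrix (Fin m) (Fin n) (ZMod 2)) : Module.Dual (ZMod 2) (Matrix (Fin m) (Fin n) (ZMod 2)) where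
  toFun Y := ∑ p, ∑ q, W p q * Y p q
  map_add' Y Y' := by
    simp only [Matrix.add_apply, mul_add, Finset.sum_add_distrib]
  map_smul' a Y := by
    simp only [Matrix.smul_apply, smul_eq_mul, RingHom.id_apply, Finset.mul_sum]
    refine Finset.sum_congr rfl fun p _ => Finset.sum_congr rfl fun q _ => ?_
    ring

/-- Evaluation of `frobR`. -/
@[simp] theorem frobR_apply (m n : ℕ) (W Y : Matrix (Fin m) (Fin n) (ZMod 2)) :
    frobR m n W Y = ∑ p, ∑ q, W p q * Y p q := rfl

/-- **Rectangular transpose transport of a bilinear computation** (`tr(XYZ) = tr(Xᵀ Zᵀ Yᵀ)` restricted to a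
constraint subspace of the first factor): from a computation of `(X', Y') ↦ X' Y'` on `S_{Kᵀ} × 𝔽₂^{l×n}`
(`X'` of size `m × l`) a computation of the same length of `(X, Y) ↦ X Y` on `S_K × 𝔽₂^{m×n}`:
`f'_i(X) = f_i(Xᵀ)`, `g'_i(Y) = Σ_{p,q} (w_i)_{pq} Y_{pq}`, `w'_i = (g_i(E_{ac}))_{ac}`. -/
def transposeCompR {l m n : ℕ} {K : List ℕ} {ι : Type*} [Fintype ι]
    (β : BilinComp (psiK m l n (K.map (trbR l m))) ι) : BilinComp (psiK l m n K) ι where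
  f i := (β.f i).comp (trSubR l m K)
  g i := frobR m n (β.w i)
  w i := Matrix.of fun a c => β.g i (Matrix.single a c 1)
  map_eq_sum X Y := by
    have key : ∀ (a : Fin l) (c : Fin n) (p : Fin m) (q : Fin n),
        (∑ i, β.f i (trSubR l m K X) * β.g i (Matrix.single a c 1) * β.w i p q) =
          if q = c then (X : Matrix (Fin l) (Fin m) (ZMod 2)) a p else 0 := by
      intro a c p q
      have h := β.map_eq_sum (trSubR l m K X) (Matrix.single a c 1)
      have h' := congrArg (fun M : Matrix (Fin m) (Fin n) (ZMod 2) => M p q) h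
      simp only [LinearMap.comp_apply, Submodule.subtype_apply, mulBilin_apply, coe_trSubR,
        Matrix.sum_apply, Matrix.smul_apply, smul_eq_mul] at h'
      rw [← h']
      by_cases hq : q = c
      · rw [hq, if_pos rfl, Matrix.mul_single_apply_same, transpose_apply, mul_one]
      · rw [if_neg hq]
        simp [Matrix.mul_apply, Matrix.single, Ne.symm hq]
    have eR : (∑ i, (β.f i (trSubR l m K X) * frobR m n (β.w i) Y) •
          (Matrix.of fun a c => β.g i (Matrix.single a c 1))) =
        Matrix.of fun a c => ∑ p, ∑ q,
          Y p q * ∑ i, β.f i (trSubR l m K X) * β.g i (Matrix.single a c 1) * β.w i p q := by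
      ext a c
      rw [Matrix.sum_apply, Matrix.of_apply]
      simp only [Matrix.smul_apply, smul_eq_mul, Matrix.of_apply, frobR_apply, Finset.mul_sum,
        Finset.sum_mul]
      rw [Finset.sum_comm]
      refine Finset.sum_congr rfl fun p _ => ?_
      rw [Finset.sum_comm]
      refine Finset.sum_congr rfl fun q _ => Finset.sum_congr rfl fun i _ => ?_
      ring
    simp only [LinearMap.comp_apply, Submodule.subtype_apply, mulBilin_apply]
    rw [eR]
    ext a c
    rw [Matrix.mul_apply, Matrix.of_apply]
    refine Finset.sum_congr rfl fun p _ => ?_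
    simp_rw [key]
    simp only [mul_ite, mul_zero, Finset.sum_ite_eq', Finset.mem_univ, if_true]
    rw [mul_comm]

/-- **Rectangular transpose transport of certified bounds**: a lower bound for all computations on
`S_K ⊆ 𝔽₂^{l×m}` (format `⟨l,m,n⟩`) is a lower bound for all computations on `S_{Kᵀ} ⊆ 𝔽₂^{m×l}` (format `⟨m,l,n⟩`). -/
theorem cert_transposeR {l m n : ℕ} {K : List ℕ} {b : ℕ} (h : Cert l m n K b) : Cert m l n (K.map (trbR l m)) b :=
  fun r β => h r (transposeCompR β)

/-! ## The sweep with hypotheses for general formats -/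

variable (l m n : ℕ)

/-- The orbit check with hypotheses: own steps, or a hypothesis bound. -/
def okH (os : List Orbit) (hyps : List (ℕ × ℕ)) (i : ℕ) : Bool :=
  orbitCheck l m n os i || decide (bnd os i ≤ hypB hyps i)

variable {l m n}

/-- The hypothesis bound is certified under the hypotheses (general format). -/
theorem cert_hypB' {os : List Orbit} {hyps : List (ℕ × ℕ)}
    (h : ∀ e ∈ hyps, Cert l m n (kOf os e.1) e.2) (i : ℕ) :
    Cert l m n (kOf os i) (hypB hyps i) := by
  unfold hypB
  split
  · next e he =>
    have hmem := List.mem_of_find?_eq_some he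
    have hi : e.1 = i := by simpa using List.find?_some he
    rw [← hi]
    exact h e hmem
  · exact fun _ _ => Nat.zero_le _

/-- **The sweep with hypotheses** (general `⟨l,m,n⟩`): if every orbit passes `okH`, all residual obligations hold
and the hypotheses hold, then every claimed bound is certified. -/
theorem sweepH (os : List Orbit) (hyps : List (ℕ × ℕ))
    (hall : ∀ i < os.length, okH l m n os hyps i = true)
    (hob : ∀ i < os.length, Obligs m n os i) (hh : ∀ e ∈ hyps, Cert l m n (kOf os e.1) e.2) :
    ∀ i < os.length, Cert l m n (kOf os i) (bnd os i) := by
  intro i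
  induction i using Nat.strong_induction_on with
  | _ i IHi =>
    intro hi
    have IH : ∀ j < i, Cert l m n (kOf os j) (bnd os j) := fun j hj => IHi j hj (lt_trans hj hi)
    have hc := hall i hi
    simp only [okH, Bool.or_eq_true, decide_eq_true_eq] at hc
    rcases hc with hc | hc
    · rw [orbitCheck, decide_eq_true_eq] at hc
      have hf := foldl_sound os i IH (kOf os i) (os.getD i default).steps 0 (fun _ _ => Nat.zero_le _) (hob i hi)
      exact fun r β => hc.trans (hf r β)
    · exact cert_mono hc (cert_hypB' hh i)

/-- **Reading off the rank bound** at the unconstrained orbit, under the hypotheses (general format). -/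
theorem le_tensorRank_of_sweepH (os : List Orbit) (hyps : List (ℕ × ℕ))
    (hall : ∀ i < os.length, okH l m n os hyps i = true)
    (hob : ∀ i < os.length, Obligs m n os i) (hh : ∀ e ∈ hyps, Cert l m n (kOf os e.1) e.2)
    (i : ℕ) (hi : i < os.length) (hK : kOf os i = []) :
    bnd os i ≤ tensorRank (matMulTensor (ZMod 2) l m n) := by
  have h := sweepH os hyps hall hob hh i hi
  rw [hK] at h
  exact le_tensorRank_matMulTensor_of_forall_constrained (subOf l m []) h

/-- `okH` from the plain orbit check. -/
theorem okH_of_orbitCheck {os : List Orbit} {hyps : List (ℕ × ℕ)} {i : ℕ}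
    (h : orbitCheck l m n os i = true) : okH l m n os hyps i = true := by
  simp [okH, h]

/-- A one-orbit certificate: if the single orbit `⟨K, b, steps⟩` passes its check and its obligations hold,
then `Cert l m n K b` (used to prove transported orbits in another format as standalone theorems). -/
theorem cert_of_single (K : List ℕ) (b : ℕ) (steps : List Step)
    (h : orbitCheck l m n [⟨K, b, steps⟩] 0 = true) (hob : Obligs m n [⟨K, b, steps⟩] 0) : Cert l m n K b := by
  have := sweep (l := l) (m := m) (n := n) [⟨K, b, steps⟩] (fun i hi => by
    have : i = 0 := by simpa using hi
    subst this; exact h) (fun i hi => by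
    have : i = 0 := by simpa using hi
    subst this; exact hob) 0 (by simp)
  simpa [kOf, bnd] using this

end Summit.Ventures.MM22.GF2Cert
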